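import Mathlib
import HarnessLib
import Summits.QuantumAdvantage.QuantumAdvantage.Theses.KummerSector
import Summits.QuantumAdvantage.QuantumAdvantage.Theorems.ArithStatLadderIqThreeMemBQPStubGuardedOr
import Literature.NumberTheory.GaussSums.KummerSector
import Literature.NumberTheory.GaussSums.KummerClassesEquidistribution
import Literature.NumberTheory.GaussSums.KummerClassesEquidistributionProofs
import Literature.Computability.Cryptography.VanDamSeroussiGaussSums

/-!
# Birth skeleton — crux `KsLowerClassesMemBQP` of route `KummerSector` (stmt-QuantumAdvantage-14588)

The crux (rank 9, LOAD-BEARING in `closes (h₁ : KsMemBQP) (h₂ : KsLowerClassesMemBQP)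
(h₃ : vanDamSeroussi2002) : QuantumAdvantage`): Kummer's classes II and III are in `BQP`,

  `L_II = bin {p prime, p ≡ 1 (3) : −√p < G_p < √p} ∈ BQP ∧ L_III = bin {p prime, p ≡ 1 (3) : G_p < −√p} ∈ BQP`,

`G_p = Σ_{x<p} cos(2πx³/p)` (= `Literature.NumberTheory.GaussSums.kummerSum p`, definitionally).

## The line: ONE quantum trit, read through TWO dictionaries (analytic ∣ algebraic) and a classical front end

For `p ≡ 1 (3)` prime and ANY primitive root `r` mod `p` let `g = cubicGaussSum p r` (the cubic Gauss
sum of `χ_{p,r}`, `χ_{p,r}(r) = ω`), `k = kummerSectorIndex p r ∈ Fin 3` (Kummer's sector: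
`arg (g ω^{-k}) ∈ (−π/3, π/3]`), `u = r^{(p−1)/3} mod p` (a primitive cube root of unity mod `p`).
Tree facts: `G_p = 2 Re g = 2√p cos(arg g)` (`KummerClasses.kummerSum_eq_two_mul_sqrt_mul_cos_arg`),
`|g| = √p`, `g³ = p·J(χ,χ)`, `J(χ,χ) = a + bω` primary (`cubicGaussSum_pow_three`,
`jacobiSum_cubicMulChar_primary`), `G_p ≠ ±√p` (`KummerClasses.kummerSum_trichotomy`).
Writing `θ = arg g = φ/3 + 2πk/3` with `φ = arg(g³) ∈ (−π, π]`, `φ ∉ {0, π}`: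
class I ⇔ `k = 0`; class II ⇔ `(k = 1 ∧ φ < 0) ∨ (k = 2 ∧ φ > 0)`; class III ⇔ `(k = 1 ∧ φ > 0) ∨ (k = 2 ∧ φ < 0)`,
and `sign φ = sign Im(g³) = sign b` where `g³ = p(a + bω)`, `(a, b)` = THE primary pair of norm `p` with
`p ∣ a + b·u` (Ireland–Rosen Ch. 9 §4 Lemma 1: `J(χ_π, χ_π) = π`, here `π = π_{p,r}`, the primary prime
above `p` dividing `u − ω`). So the class of `p` is a function of the QUANTUM trit `k` (van Dam–Seroussi
phase estimation of `arg g` + classical comparison with the three candidates `φ/3 + 2πj/3`, `2π/3`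
apart) and the CLASSICAL bit `sign b` (Cornacchia + the divisibility normalisation). Five named stubs:

* `stub_tritDictionary` (S1, M, analytic number theory — Ireland–Rosen Ch. 9 §12): for every primitive
  root `r`: `(−√p < G_p < √p) ↔ (k = 1 ∧ Im g³ < 0) ∨ (k = 2 ∧ Im g³ > 0)` and
  `(G_p < −√p) ↔ (k = 1 ∧ Im g³ > 0) ∨ (k = 2 ∧ Im g³ < 0)`. Plan: `G_p = 2√p cos θ`, sector
  characterisation `arg_mul_omega_inv_pow_mem_iff`, `Im(g³) = |g|³ sin 3θ`, trichotomy for the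
  boundary angles; pure trigonometric case analysis over tree theorems.
* `stub_cubicGaussSumPhase` (S2, L, DEBT STUB = the Literature named fact
  `Literature.Computability.Cryptography.VanDamSeroussi2002_cubicGaussSumPhase_qsolvable`, van Dam–Seroussi
  2002 Thm 1 for `χ_{p,r}` at every fixed precision `t`; its discharge programme
  `VanDamSeroussiCubic*.lean` / `cubic_of_general` is under way in the tree; closes by
  `exact …_holds` the day that lands).
* `stub_eisensteinDatum` (S3, M, algebraic number theory — Ireland–Rosen Ch. 9 §4 Lemma 1 in
  coordinates): for every primitive root `r` there is a pair `(a, b) ∈ ℤ²` with `a² − ab + b² = p`,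
  `a ≡ −1 (3)`, `b ≡ 0 (3)`, `p ∣ a + b r^{(p−1)/3}`, and EVERY such pair has `g³ = p(a + bω)`.
  Plan: existence = `J(χ_{p,r},χ_{p,r})` itself (`jacobiSum_cubicMulChar_primary`, norm `p` by
  `KummerClasses.normSq_jacobiSum_cubicMulChar` + `normSq_int_add_int_mul_omega`, and `J ↦ 0` under
  `ℤ[ω] → 𝔽_p, ω ↦ u`, since `χ(x) ↦ x^{(p−1)/3}` and `Σ_x x^m (1−x)^m = 0`, `2m < p − 1`);
  rigidity = two primary norm-`p` elements of the prime ideal `(p, u − ω)` differ by a unit, and the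
  only unit preserving primarity is `1` (six-case check).
* `stub_exactSectorWithAdvice` (S4, M/L, quantum → exact — the "algebraic quantisation" step): granted S2,
  the search problem `⟨bin p, ⟨bin r, ⟨int a, int b⟩⟩⟩ ↦ bin k` (EXACT Kummer sector) on the promise
  `p` prime, `p ≡ 1 (3)`, `r` primitive root, `g³ = p(a + bω)`, is `IsQSolvable`. Plan: run the vDS
  family at `t = 12` (classical re-encoding of the input, `isQSolvable_classicalWrap_holds`): its output
  `m` has `|arg(g e^{−2πim/12})| ≤ π/6`; the candidates `φ/3 + 2πj/3` (`φ = arg(a + bω)`) are `2π/3`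
  apart, so `j = round((m − 2φ/π)/4)` with `φ` needed only to `±π/4` — an octant test on `(2a − b, b√3)`
  by integer comparisons (`3b²` vs `(2a − b)²`); post-process in `FP`; `k = j` (the sector of a cube
  root of `p(a + bω) ω^{3j}`… i.e. `arg(g ω^{-j}) = φ/3 ∈ (−π/3, π/3]`).
* `stub_sectorSignFrontEnd` (S5, L/XL, HARDEST AS TYPED — classical front end + promise packaging):
  granted S3 (as a black box: representations exist for the sampled `r` and pin `g³`) and the solver
  of S4, the guard `bin {p prime, p ≡ 1 (3)} ∈ BQP` (`PRIMES ∈ P`, `P ⊆ BQP`) and the two PROMISE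
  problems `Q_II = (bin {… ∀ r a b admissible → D_II(k_r, b)}, bin {… → ¬D_II(k_r, b)})`, `Q_III`
  likewise, are in `PromiseBQP`, where `D_II(k, b) = (k = 1 ∧ b < 0) ∨ (k = 2 ∧ b > 0)`,
  `D_III(k, b) = (k = 1 ∧ b > 0) ∨ (k = 2 ∧ b < 0)`. Plan: sample a primitive root (Shor factoring of
  `p − 1`, tree `isQSolvable_factoring_holds`; certify `r^{(p−1)/q} ≠ 1`; density
  `φ(n)/n ≥ 1/(log₂ n + 1)`), Cornacchia/Euclid for `(a, b)` with the normalisation `p ∣ a + b u`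
  (complete whenever a representation exists — S3), feed `⟨p, r, a, b⟩` to the S4 solver, output
  `D(k, b)`; amplification and packaging as in `Theorems/ArithStatLadderIqThreeMemBQPStubFrontEnd`.

Composition `KsLowerClassesMemBQP_of` (sorry-free): `S5 S3 (S4 S2)` gives the guard and the two promise
problems; the tree theorem `ArithStatLadder.IqThreeMemBQP.stub_guardedOr` (generic guarded-OR closure of
`BQP`, LANDED) turns "guard ∈ BQP, Q ∈ PromiseBQP, L ⊆ guard, members of L are yes-instances, guarded
non-members are no-instances" into `L ∈ BQP`; the two covering facts are S1 (class ↔ (k, sign Im g³)),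
S3 (`g³ = p(a + bω)`) and `Im(p(a + bω)) = p·b·Im ω`, `Im ω = sin(2π/3) > 0` (proved here).

Why this cut: S1/S3 are theorem-sized number theory with all inputs in the tree; S2 is the one printed
quantum theorem (being discharged); S4 isolates the quantum-to-EXACT decision (the route's "algebraic
quantisation"); S5 is pure complexity plumbing with its number theory delivered as hypotheses — the
stub where "may fail AS TYPED" lives. The sibling crux `KsMemBQP` (class I ⇔ `k = 0`) falls to
S2 + S4 + S5-type packaging with NO sign bit, as the route predicts ("expected to fall with #2").

Disproof used: none exists (`ledger crux ls stmt-QuantumAdvantage-14588`: no workfiles, no `Disproof.lean`,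
no `Negative/` lemmas, 2026-08-17). Negatives index (`ledger negatives --problem QuantumAdvantage`,
2026-08-17: 6 refuted statements — RegulatorThird, ShorLocallyDark, CubicStability, SpinorFlattening,
KummerSector `KsNotFrobenian` (Frobenian tables, `fs ∋ 0`), SeparableFrames): none concerns membership of
a Kummer class language in `BQP`, the sector/sign dictionary or the Eisenstein datum — no stub restates one.
BC3 probes (folder `bc/KsLowerClassesMemBQP_probes.lean`, stub statements inlined, never importing this
file): `stubᵢ → KsLowerClassesMemBQP` and `stubᵢ → QuantumAdvantage` by
`first | exact? | simpa | aesop` FAIL for all five stubs; `example : stubᵢ := by exact?` fails too.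
`sorry` occurs ONLY in the five `stub_*` theorems.
-/

set_option linter.dupNamespace false
set_option linter.unusedVariables false

noncomputable section

namespace Summit.QuantumAdvantage.QuantumAdvantage.Cruxes.KsLowerClassesMemBQP.Birth

open Summit.QuantumAdvantage.QuantumAdvantage.Theses.KummerSector

/-! ## The five registered stubs (signatures over tree constants only; the ONLY sorries of the file) -/

/-- **S1 `stub_tritDictionary`** (M, analytic): Kummer's classes II and III in terms of the sector
`k = kummerSectorIndex p r` and the sign of `Im g³`, for every primitive root `r`.
[cite: IrelandRosen1990, Ch. 9 §12 (pp. 137–138), Ch. 9 §4 Corollary] -/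
theorem stub_tritDictionary :
    ∀ p r : ℕ, p.Prime → p % 3 = 1 → IsPrimitiveRoot (r : ZMod p) (p - 1) →
      ((-Real.sqrt (p : ℝ) < Literature.NumberTheory.GaussSums.kummerSum p ∧
          Literature.NumberTheory.GaussSums.kummerSum p < Real.sqrt (p : ℝ)) ↔
        ((Literature.NumberTheory.GaussSums.kummerSectorIndex p r = 1 ∧
            (Literature.NumberTheory.GaussSums.cubicGaussSum p r ^ 3).im < 0) ∨
          (Literature.NumberTheory.GaussSums.kummerSectorIndex p r = 2 ∧
            0 < (Literature.NumberTheory.GaussSums.cubicGaussSum p r ^ 3).im))) ∧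
      ((Literature.NumberTheory.GaussSums.kummerSum p < -Real.sqrt (p : ℝ)) ↔
        ((Literature.NumberTheory.GaussSums.kummerSectorIndex p r = 1 ∧
            0 < (Literature.NumberTheory.GaussSums.cubicGaussSum p r ^ 3).im) ∨
          (Literature.NumberTheory.GaussSums.kummerSectorIndex p r = 2 ∧
            (Literature.NumberTheory.GaussSums.cubicGaussSum p r ^ 3).im < 0))) := by
  sorry

/-- **S2 `stub_cubicGaussSumPhase`** (L, debt stub = the Literature named fact, by name): van Dam–Seroussi
2002, Theorem 1, for the cubic residue character `χ_{p,r}` at every fixed precision `t`.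
[cite: VanDamSeroussi2002, §4 Theorem 1] -/
theorem stub_cubicGaussSumPhase :
    Literature.Computability.Cryptography.VanDamSeroussi2002_cubicGaussSumPhase_qsolvable := by
  sorry

/-- **S3 `stub_eisensteinDatum`** (M, algebraic): existence and rigidity of the primary pair `(a, b)` of
norm `p` with `p ∣ a + b r^{(p−1)/3}`, and `g³ = p (a + bω)` for it (Ireland–Rosen Ch. 9 §4, Lemma 1:
`J(χ_π, χ_π) = π`, in coordinates). [cite: IrelandRosen1990, Ch. 9 §4 Lemma 1 and Corollary; Prop. 8.3.4] -/
theorem stub_eisensteinDatum :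
    ∀ p r : ℕ, p.Prime → p % 3 = 1 → IsPrimitiveRoot (r : ZMod p) (p - 1) →
      (∃ a b : ℤ, a ^ 2 - a * b + b ^ 2 = (p : ℤ) ∧ a ≡ -1 [ZMOD 3] ∧ b ≡ 0 [ZMOD 3] ∧
          (p : ℤ) ∣ a + b * (r : ℤ) ^ ((p - 1) / 3)) ∧
      (∀ a b : ℤ, a ^ 2 - a * b + b ^ 2 = (p : ℤ) → a ≡ -1 [ZMOD 3] → b ≡ 0 [ZMOD 3] →
          (p : ℤ) ∣ a + b * (r : ℤ) ^ ((p - 1) / 3) →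
        Literature.NumberTheory.GaussSums.cubicGaussSum p r ^ 3 =
          (p : ℂ) * ((a : ℂ) + (b : ℂ) * Literature.NumberTheory.GaussSums.omega)) := by
  sorry

/-- **S4 `stub_exactSectorWithAdvice`** (M/L, quantum → exact): granted S2, Kummer's sector EXACTLY,
with the Eisenstein datum `(a, b)` as advice (`g³ = p(a + bω)` on the promise).
[cite: VanDamSeroussi2002, §4 Theorem 1; IrelandRosen1990, Ch. 9 §4 Corollary]
[cite: BernsteinVazirani1997, §8 (classical computation inside quantum machines)] -/
theorem stub_exactSectorWithAdvice :
    Literature.Computability.Cryptography.VanDamSeroussi2002_cubicGaussSumPhase_qsolvable →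
      Literature.Computability.Cryptography.IsQSolvable fun x : List Bool =>
        {y | ∀ (p r : ℕ) (a b : ℤ), p.Prime → p % 3 = 1 → IsPrimitiveRoot (r : ZMod p) (p - 1) →
          x = Literature.Computability.Complexity.boolPair (Computability.encodeNat p)
                (Literature.Computability.Complexity.boolPair (Computability.encodeNat r)
                  (Literature.Computability.Complexity.boolPair
                    (Literature.Computability.Complexity.encodingIntBool.encode a)
                    (Literature.Computability.Complexity.encodingIntBool.encode b))) →
          Literature.NumberTheory.GaussSums.cubicGaussSum p r ^ 3 =
            (p : ℂ) * ((a : ℂ) + (b : ℂ) * Literature.NumberTheory.GaussSums.omega) →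
          Computability.encodeNat
              ((Literature.NumberTheory.GaussSums.kummerSectorIndex p r : Fin 3) : ℕ) <+: y} := by
  sorry

/-- **S5 `stub_sectorSignFrontEnd`** (L/XL, hardest AS TYPED — classical front end and promise
packaging): granted the Eisenstein datum (S3, black box) and the exact-sector solver (conclusion of S4),
the guard `bin {p prime, p ≡ 1 (3)}` is in `BQP` and the two sector–sign promise problems are in
`PromiseBQP`. [cite: VanDamSeroussi2002, §4; BernsteinVazirani1997, §8; Shor1997, §5]
[cite: BennettBernsteinBrassardVazirani1997, Cor. 4.15] -/
theorem stub_sectorSignFrontEnd :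
    (∀ p r : ℕ, p.Prime → p % 3 = 1 → IsPrimitiveRoot (r : ZMod p) (p - 1) →
      (∃ a b : ℤ, a ^ 2 - a * b + b ^ 2 = (p : ℤ) ∧ a ≡ -1 [ZMOD 3] ∧ b ≡ 0 [ZMOD 3] ∧
          (p : ℤ) ∣ a + b * (r : ℤ) ^ ((p - 1) / 3)) ∧
      (∀ a b : ℤ, a ^ 2 - a * b + b ^ 2 = (p : ℤ) → a ≡ -1 [ZMOD 3] → b ≡ 0 [ZMOD 3] →
          (p : ℤ) ∣ a + b * (r : ℤ) ^ ((p - 1) / 3) →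
        Literature.NumberTheory.GaussSums.cubicGaussSum p r ^ 3 =
          (p : ℂ) * ((a : ℂ) + (b : ℂ) * Literature.NumberTheory.GaussSums.omega))) →
    (Literature.Computability.Cryptography.IsQSolvable fun x : List Bool =>
        {y | ∀ (p r : ℕ) (a b : ℤ), p.Prime → p % 3 = 1 → IsPrimitiveRoot (r : ZMod p) (p - 1) →
          x = Literature.Computability.Complexity.boolPair (Computability.encodeNat p)
                (Literature.Computability.Complexity.boolPair (Computability.encodeNat r)
                  (Literature.Computability.Complexity.boolPair
                    (Literature.Computability.Complexity.encodingIntBool.encode a)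
                    (Literature.Computability.Complexity.encodingIntBool.encode b))) →
          Literature.NumberTheory.GaussSums.cubicGaussSum p r ^ 3 =
            (p : ℂ) * ((a : ℂ) + (b : ℂ) * Literature.NumberTheory.GaussSums.omega) →
          Computability.encodeNat
              ((Literature.NumberTheory.GaussSums.kummerSectorIndex p r : Fin 3) : ℕ) <+: y}) →
    Computability.encodingNatBool.toLanguage {p : ℕ | p.Prime ∧ p % 3 = 1} ∈
        Literature.Computability.Cryptography.BQP ∧
      (⟨Computability.encodingNatBool.toLanguage {p : ℕ | p.Prime ∧ p % 3 = 1 ∧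
            ∀ (r : ℕ) (a b : ℤ), IsPrimitiveRoot (r : ZMod p) (p - 1) →
              a ^ 2 - a * b + b ^ 2 = (p : ℤ) → a ≡ -1 [ZMOD 3] → b ≡ 0 [ZMOD 3] →
              (p : ℤ) ∣ a + b * (r : ℤ) ^ ((p - 1) / 3) →
                ((Literature.NumberTheory.GaussSums.kummerSectorIndex p r = 1 ∧ b < 0) ∨
                  (Literature.NumberTheory.GaussSums.kummerSectorIndex p r = 2 ∧ 0 < b))},
        Computability.encodingNatBool.toLanguage {p : ℕ | p.Prime ∧ p % 3 = 1 ∧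
            ∀ (r : ℕ) (a b : ℤ), IsPrimitiveRoot (r : ZMod p) (p - 1) →
              a ^ 2 - a * b + b ^ 2 = (p : ℤ) → a ≡ -1 [ZMOD 3] → b ≡ 0 [ZMOD 3] →
              (p : ℤ) ∣ a + b * (r : ℤ) ^ ((p - 1) / 3) →
                ¬ ((Literature.NumberTheory.GaussSums.kummerSectorIndex p r = 1 ∧ b < 0) ∨
                  (Literature.NumberTheory.GaussSums.kummerSectorIndex p r = 2 ∧ 0 < b))}⟩ :
          Literature.Computability.Complexity.PromiseProblem) ∈
        Literature.Computability.Cryptography.PromiseBQP ∧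
      (⟨Computability.encodingNatBool.toLanguage {p : ℕ | p.Prime ∧ p % 3 = 1 ∧
            ∀ (r : ℕ) (a b : ℤ), IsPrimitiveRoot (r : ZMod p) (p - 1) →
              a ^ 2 - a * b + b ^ 2 = (p : ℤ) → a ≡ -1 [ZMOD 3] → b ≡ 0 [ZMOD 3] →
              (p : ℤ) ∣ a + b * (r : ℤ) ^ ((p - 1) / 3) →
                ((Literature.NumberTheory.GaussSums.kummerSectorIndex p r = 1 ∧ 0 < b) ∨
                  (Literature.NumberTheory.GaussSums.kummerSectorIndex p r = 2 ∧ b < 0))},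
        Computability.encodingNatBool.toLanguage {p : ℕ | p.Prime ∧ p % 3 = 1 ∧
            ∀ (r : ℕ) (a b : ℤ), IsPrimitiveRoot (r : ZMod p) (p - 1) →
              a ^ 2 - a * b + b ^ 2 = (p : ℤ) → a ≡ -1 [ZMOD 3] → b ≡ 0 [ZMOD 3] →
              (p : ℤ) ∣ a + b * (r : ℤ) ^ ((p - 1) / 3) →
                ¬ ((Literature.NumberTheory.GaussSums.kummerSectorIndex p r = 1 ∧ 0 < b) ∨
                  (Literature.NumberTheory.GaussSums.kummerSectorIndex p r = 2 ∧ b < 0))}⟩ :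
          Literature.Computability.Complexity.PromiseProblem) ∈
        Literature.Computability.Cryptography.PromiseBQP := by
  sorry

/-! ## Sorry-free helpers of the composition -/

/-- `Im ω = sin(2π/3) > 0`. [folklore] -/
theorem omega_im_pos : 0 < Literature.NumberTheory.GaussSums.omega.im := by
  have h : Literature.NumberTheory.GaussSums.omega =
      Complex.exp (((2 * Real.pi / 3 : ℝ) : ℂ) * Complex.I) := by
    unfold Literature.NumberTheory.GaussSums.omega
    congr 1
    push_cast
    ring
  rw [h, Complex.exp_ofReal_mul_I_im]
  exact Real.sin_pos_of_pos_of_lt_pi (by positivity) (by linarith [Real.pi_pos])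

/-- `Im (p (a + bω)) = (p · Im ω) · b`. [folklore] -/
theorem im_natCast_mul_int_add_int_mul_omega (p : ℕ) (a b : ℤ) :
    ((p : ℂ) * ((a : ℂ) + (b : ℂ) * Literature.NumberTheory.GaussSums.omega)).im =
      ((p : ℝ) * Literature.NumberTheory.GaussSums.omega.im) * (b : ℝ) := by
  simp only [Complex.mul_im, Complex.add_im, Complex.add_re, Complex.mul_re, Complex.natCast_re,
    Complex.natCast_im, Complex.intCast_re, Complex.intCast_im]
  ring

/-- Sign transfer: if `g³ = p(a + bω)` with `p > 0` then `Im g³` and `b` have the same sign. [folklore] -/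
theorem sign_im_of_cube_eq {p : ℕ} (hp : 0 < p) {a b : ℤ} {z : ℂ}
    (hz : z = (p : ℂ) * ((a : ℂ) + (b : ℂ) * Literature.NumberTheory.GaussSums.omega)) :
    (0 < z.im ↔ 0 < b) ∧ (z.im < 0 ↔ b < 0) := by
  have hP : 0 < (p : ℝ) * Literature.NumberTheory.GaussSums.omega.im :=
    mul_pos (by exact_mod_cast hp) omega_im_pos
  have him : z.im = ((p : ℝ) * Literature.NumberTheory.GaussSums.omega.im) * (b : ℝ) := by
    rw [hz]; exact im_natCast_mul_int_add_int_mul_omega p a b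
  rw [him]
  refine ⟨⟨fun h => ?_, fun h => ?_⟩, ⟨fun h => ?_, fun h => ?_⟩⟩
  · exact Int.cast_pos.1 (pos_of_mul_pos_right h hP.le)
  · exact mul_pos hP (Int.cast_pos.2 h)
  · exact Int.cast_lt_zero.1 (neg_of_mul_neg_right h hP.le)
  · exact mul_neg_of_pos_of_neg hP (Int.cast_lt_zero.2 h)

/-- The covering pattern behind both windows: a set `S` of primes `p ≡ 1 (3)` whose members are
yes-instances and whose guarded non-members are no-instances of a `PromiseBQP` problem is a `BQP`
language — the `E = ∅`, `Q₁ = Q₂ = Q₃` instance of the tree's guarded-OR closure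
`ArithStatLadder.IqThreeMemBQP.stub_guardedOr`. [cite: BennettBernsteinBrassardVazirani1997, Cor. 4.15] -/
theorem toLanguage_mem_BQP_of_cover (S Y N : Set ℕ)
    (hG : Computability.encodingNatBool.toLanguage {p : ℕ | p.Prime ∧ p % 3 = 1} ∈
      Literature.Computability.Cryptography.BQP)
    (hQ : (⟨Computability.encodingNatBool.toLanguage Y, Computability.encodingNatBool.toLanguage N⟩ :
        Literature.Computability.Complexity.PromiseProblem) ∈
      Literature.Computability.Cryptography.PromiseBQP)
    (hS : ∀ p, p ∈ S → p.Prime ∧ p % 3 = 1) (hyes : ∀ p, p ∈ S → p ∈ Y)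
    (hno : ∀ p, p.Prime → p % 3 = 1 → p ∉ S → p ∈ N) :
    Computability.encodingNatBool.toLanguage S ∈ Literature.Computability.Cryptography.BQP := by
  refine Summit.QuantumAdvantage.QuantumAdvantage.Theorems.ArithStatLadder.IqThreeMemBQP.stub_guardedOr
    _ _ _ _ _ ∅ hG hQ hQ hQ ?_ ?_
  · intro w _ hw
    obtain ⟨p, hp, rfl⟩ := hw
    exact ⟨(Computability.encodingNatBool.mem_toLanguage_iff _ p).2 (hS p hp),
      Or.inl ((Computability.encodingNatBool.mem_toLanguage_iff _ p).2 (hyes p hp))⟩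
  · intro w _ hw
    by_cases hGw : w ∈ Computability.encodingNatBool.toLanguage {p : ℕ | p.Prime ∧ p % 3 = 1}
    · obtain ⟨p, hp, rfl⟩ := hGw
      have hpS : p ∉ S := fun h => hw ((Computability.encodingNatBool.mem_toLanguage_iff _ p).2 h)
      have hN : Computability.encodingNatBool.encode p ∈ Computability.encodingNatBool.toLanguage N :=
        (Computability.encodingNatBool.mem_toLanguage_iff _ p).2 (hno p hp.1 hp.2 hpS)
      exact Or.inr ⟨hN, hN, hN⟩
    · exact Or.inl hGw

/-! ## Name-keyed aliases of the stub statements (hypotheses of the composition; A12 skeleton audit: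
every `Prop` hypothesis of the theorem concluding the crux must be a registered obligation BY NAME) -/

namespace Registered

/-- Alias of S1's statement (byte-identical body), keyed by the registered stub name. -/
abbrev stub_tritDictionary : Prop :=
    ∀ p r : ℕ, p.Prime → p % 3 = 1 → IsPrimitiveRoot (r : ZMod p) (p - 1) →
      ((-Real.sqrt (p : ℝ) < Literature.NumberTheory.GaussSums.kummerSum p ∧
          Literature.NumberTheory.GaussSums.kummerSum p < Real.sqrt (p : ℝ)) ↔
        ((Literature.NumberTheory.GaussSums.kummerSectorIndex p r = 1 ∧
            (Literature.NumberTheory.GaussSums.cubicGaussSum p r ^ 3).im < 0) ∨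
          (Literature.NumberTheory.GaussSums.kummerSectorIndex p r = 2 ∧
            0 < (Literature.NumberTheory.GaussSums.cubicGaussSum p r ^ 3).im))) ∧
      ((Literature.NumberTheory.GaussSums.kummerSum p < -Real.sqrt (p : ℝ)) ↔
        ((Literature.NumberTheory.GaussSums.kummerSectorIndex p r = 1 ∧
            0 < (Literature.NumberTheory.GaussSums.cubicGaussSum p r ^ 3).im) ∨
          (Literature.NumberTheory.GaussSums.kummerSectorIndex p r = 2 ∧
            (Literature.NumberTheory.GaussSums.cubicGaussSum p r ^ 3).im < 0)))

/-- Alias of S2's statement (the Literature named fact), keyed by the registered stub name. -/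
abbrev stub_cubicGaussSumPhase : Prop :=
    Literature.Computability.Cryptography.VanDamSeroussi2002_cubicGaussSumPhase_qsolvable

/-- Alias of S3's statement (byte-identical body), keyed by the registered stub name. -/
abbrev stub_eisensteinDatum : Prop :=
    ∀ p r : ℕ, p.Prime → p % 3 = 1 → IsPrimitiveRoot (r : ZMod p) (p - 1) →
      (∃ a b : ℤ, a ^ 2 - a * b + b ^ 2 = (p : ℤ) ∧ a ≡ -1 [ZMOD 3] ∧ b ≡ 0 [ZMOD 3] ∧
          (p : ℤ) ∣ a + b * (r : ℤ) ^ ((p - 1) / 3)) ∧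
      (∀ a b : ℤ, a ^ 2 - a * b + b ^ 2 = (p : ℤ) → a ≡ -1 [ZMOD 3] → b ≡ 0 [ZMOD 3] →
          (p : ℤ) ∣ a + b * (r : ℤ) ^ ((p - 1) / 3) →
        Literature.NumberTheory.GaussSums.cubicGaussSum p r ^ 3 =
          (p : ℂ) * ((a : ℂ) + (b : ℂ) * Literature.NumberTheory.GaussSums.omega))

/-- Alias of S4's statement (byte-identical body), keyed by the registered stub name. -/
abbrev stub_exactSectorWithAdvice : Prop :=
    Literature.Computability.Cryptography.VanDamSeroussi2002_cubicGaussSumPhase_qsolvable →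
      Literature.Computability.Cryptography.IsQSolvable fun x : List Bool =>
        {y | ∀ (p r : ℕ) (a b : ℤ), p.Prime → p % 3 = 1 → IsPrimitiveRoot (r : ZMod p) (p - 1) →
          x = Literature.Computability.Complexity.boolPair (Computability.encodeNat p)
                (Literature.Computability.Complexity.boolPair (Computability.encodeNat r)
                  (Literature.Computability.Complexity.boolPair
                    (Literature.Computability.Complexity.encodingIntBool.encode a)
                    (Literature.Computability.Complexity.encodingIntBool.encode b))) →
          Literature.NumberTheory.GaussSums.cubicGaussSum p r ^ 3 =
            (p : ℂ) * ((a : ℂ) + (b : ℂ) * Literature.NumberTheory.GaussSums.omega) →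
          Computability.encodeNat
              ((Literature.NumberTheory.GaussSums.kummerSectorIndex p r : Fin 3) : ℕ) <+: y}

/-- Alias of S5's statement (byte-identical body), keyed by the registered stub name. -/
abbrev stub_sectorSignFrontEnd : Prop :=
    (∀ p r : ℕ, p.Prime → p % 3 = 1 → IsPrimitiveRoot (r : ZMod p) (p - 1) →
      (∃ a b : ℤ, a ^ 2 - a * b + b ^ 2 = (p : ℤ) ∧ a ≡ -1 [ZMOD 3] ∧ b ≡ 0 [ZMOD 3] ∧
          (p : ℤ) ∣ a + b * (r : ℤ) ^ ((p - 1) / 3)) ∧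
      (∀ a b : ℤ, a ^ 2 - a * b + b ^ 2 = (p : ℤ) → a ≡ -1 [ZMOD 3] → b ≡ 0 [ZMOD 3] →
          (p : ℤ) ∣ a + b * (r : ℤ) ^ ((p - 1) / 3) →
        Literature.NumberTheory.GaussSums.cubicGaussSum p r ^ 3 =
          (p : ℂ) * ((a : ℂ) + (b : ℂ) * Literature.NumberTheory.GaussSums.omega))) →
    (Literature.Computability.Cryptography.IsQSolvable fun x : List Bool =>
        {y | ∀ (p r : ℕ) (a b : ℤ), p.Prime → p % 3 = 1 → IsPrimitiveRoot (r : ZMod p) (p - 1) →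
          x = Literature.Computability.Complexity.boolPair (Computability.encodeNat p)
                (Literature.Computability.Complexity.boolPair (Computability.encodeNat r)
                  (Literature.Computability.Complexity.boolPair
                    (Literature.Computability.Complexity.encodingIntBool.encode a)
                    (Literature.Computability.Complexity.encodingIntBool.encode b))) →
          Literature.NumberTheory.GaussSums.cubicGaussSum p r ^ 3 =
            (p : ℂ) * ((a : ℂ) + (b : ℂ) * Literature.NumberTheory.GaussSums.omega) →
          Computability.encodeNat
              ((Literature.NumberTheory.GaussSums.kummerSectorIndex p r : Fin 3) : ℕ) <+: y}) →
    Computability.encodingNatBool.toLanguage {p : ℕ | p.Prime ∧ p % 3 = 1} ∈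
        Literature.Computability.Cryptography.BQP ∧
      (⟨Computability.encodingNatBool.toLanguage {p : ℕ | p.Prime ∧ p % 3 = 1 ∧
            ∀ (r : ℕ) (a b : ℤ), IsPrimitiveRoot (r : ZMod p) (p - 1) →
              a ^ 2 - a * b + b ^ 2 = (p : ℤ) → a ≡ -1 [ZMOD 3] → b ≡ 0 [ZMOD 3] →
              (p : ℤ) ∣ a + b * (r : ℤ) ^ ((p - 1) / 3) →
                ((Literature.NumberTheory.GaussSums.kummerSectorIndex p r = 1 ∧ b < 0) ∨
                  (Literature.NumberTheory.GaussSums.kummerSectorIndex p r = 2 ∧ 0 < b))},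
        Computability.encodingNatBool.toLanguage {p : ℕ | p.Prime ∧ p % 3 = 1 ∧
            ∀ (r : ℕ) (a b : ℤ), IsPrimitiveRoot (r : ZMod p) (p - 1) →
              a ^ 2 - a * b + b ^ 2 = (p : ℤ) → a ≡ -1 [ZMOD 3] → b ≡ 0 [ZMOD 3] →
              (p : ℤ) ∣ a + b * (r : ℤ) ^ ((p - 1) / 3) →
                ¬ ((Literature.NumberTheory.GaussSums.kummerSectorIndex p r = 1 ∧ b < 0) ∨
                  (Literature.NumberTheory.GaussSums.kummerSectorIndex p r = 2 ∧ 0 < b))}⟩ :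
          Literature.Computability.Complexity.PromiseProblem) ∈
        Literature.Computability.Cryptography.PromiseBQP ∧
      (⟨Computability.encodingNatBool.toLanguage {p : ℕ | p.Prime ∧ p % 3 = 1 ∧
            ∀ (r : ℕ) (a b : ℤ), IsPrimitiveRoot (r : ZMod p) (p - 1) →
              a ^ 2 - a * b + b ^ 2 = (p : ℤ) → a ≡ -1 [ZMOD 3] → b ≡ 0 [ZMOD 3] →
              (p : ℤ) ∣ a + b * (r : ℤ) ^ ((p - 1) / 3) →
                ((Literature.NumberTheory.GaussSums.kummerSectorIndex p r = 1 ∧ 0 < b) ∨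
                  (Literature.NumberTheory.GaussSums.kummerSectorIndex p r = 2 ∧ b < 0))},
        Computability.encodingNatBool.toLanguage {p : ℕ | p.Prime ∧ p % 3 = 1 ∧
            ∀ (r : ℕ) (a b : ℤ), IsPrimitiveRoot (r : ZMod p) (p - 1) →
              a ^ 2 - a * b + b ^ 2 = (p : ℤ) → a ≡ -1 [ZMOD 3] → b ≡ 0 [ZMOD 3] →
              (p : ℤ) ∣ a + b * (r : ℤ) ^ ((p - 1) / 3) →
                ¬ ((Literature.NumberTheory.GaussSums.kummerSectorIndex p r = 1 ∧ 0 < b) ∨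
                  (Literature.NumberTheory.GaussSums.kummerSectorIndex p r = 2 ∧ b < 0))}⟩ :
          Literature.Computability.Complexity.PromiseProblem) ∈
        Literature.Computability.Cryptography.PromiseBQP

end Registered

/-! ## Kernel-checked composition: the five stub statements give the crux BY NAME -/

/-- **COMPOSITION (real proof, no sorry).** From the statements of S1–S5 — as hypotheses, keyed by the
registered stub names through the `Registered.*` aliases (definitionally the inlined stub signatures; the
`example` below checks that each stub theorem inhabits its alias) — the route decl `KsLowerClassesMemBQP`
follows BY NAME: `h5 h3 (h4 h2)` supplies the guard and the two promise problems; the covering facts are S1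
(class ↔ (k, sign Im g³)), S3 (`g³ = p(a + bω)`) and the sign transfer `sign Im g³ = sign b`;
`toLanguage_mem_BQP_of_cover` (the tree's guarded-OR closure of `BQP`) concludes each conjunct. -/
theorem KsLowerClassesMemBQP_of (h1 : Registered.stub_tritDictionary) (h2 : Registered.stub_cubicGaussSumPhase)
    (h3 : Registered.stub_eisensteinDatum) (h4 : Registered.stub_exactSectorWithAdvice)
    (h5 : Registered.stub_sectorSignFrontEnd) : KsLowerClassesMemBQP := by
  obtain ⟨hG, hQ2, hQ3⟩ := h5 h3 (h4 h2)
  -- the sign transfer for every admissible `(p, r, a, b)`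
  have hsign : ∀ (p r : ℕ) (a b : ℤ), p.Prime → p % 3 = 1 → IsPrimitiveRoot (r : ZMod p) (p - 1) →
      a ^ 2 - a * b + b ^ 2 = (p : ℤ) → a ≡ -1 [ZMOD 3] → b ≡ 0 [ZMOD 3] →
      (p : ℤ) ∣ a + b * (r : ℤ) ^ ((p - 1) / 3) →
        ((0 < (Literature.NumberTheory.GaussSums.cubicGaussSum p r ^ 3).im ↔ 0 < b) ∧
          ((Literature.NumberTheory.GaussSums.cubicGaussSum p r ^ 3).im < 0 ↔ b < 0)) :=
    fun p r a b hp hp3 hr hN ha hb hd =>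
      sign_im_of_cube_eq hp.pos ((h3 p r hp hp3 hr).2 a b hN ha hb hd)
  unfold KsLowerClassesMemBQP
  refine ⟨toLanguage_mem_BQP_of_cover _ _ _ hG hQ2 (fun p hp => ⟨hp.1, hp.2.1⟩) ?_ ?_,
    toLanguage_mem_BQP_of_cover _ _ _ hG hQ3 (fun p hp => ⟨hp.1, hp.2.1⟩) ?_ ?_⟩
  · -- class II members are yes-instances of `Q_II`
    rintro p ⟨hp, hp3, hlo, hhi⟩
    refine ⟨hp, hp3, fun r a b hr hN ha hb hd => ?_⟩
    have hD := ((h1 p r hp hp3 hr).1).1 ⟨hlo, hhi⟩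
    have hs := hsign p r a b hp hp3 hr hN ha hb hd
    rcases hD with ⟨hk, him⟩ | ⟨hk, him⟩
    · exact Or.inl ⟨hk, hs.2.1 him⟩
    · exact Or.inr ⟨hk, hs.1.1 him⟩
  · -- guarded non-members of class II are no-instances of `Q_II`
    intro p hp hp3 hpS
    refine ⟨hp, hp3, fun r a b hr hN ha hb hd hD => hpS ?_⟩
    have hs := hsign p r a b hp hp3 hr hN ha hb hd
    refine ⟨hp, hp3, ((h1 p r hp hp3 hr).1).2 ?_⟩
    rcases hD with ⟨hk, hb0⟩ | ⟨hk, hb0⟩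
    · exact Or.inl ⟨hk, hs.2.2 hb0⟩
    · exact Or.inr ⟨hk, hs.1.2 hb0⟩
  · -- class III members are yes-instances of `Q_III`
    rintro p ⟨hp, hp3, hlt⟩
    refine ⟨hp, hp3, fun r a b hr hN ha hb hd => ?_⟩
    have hD := ((h1 p r hp hp3 hr).2).1 hlt
    have hs := hsign p r a b hp hp3 hr hN ha hb hd
    rcases hD with ⟨hk, him⟩ | ⟨hk, him⟩
    · exact Or.inl ⟨hk, hs.1.1 him⟩
    · exact Or.inr ⟨hk, hs.2.1 him⟩
  · -- guarded non-members of class III are no-instances of `Q_III`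
    intro p hp hp3 hpS
    refine ⟨hp, hp3, fun r a b hr hN ha hb hd hD => hpS ?_⟩
    have hs := hsign p r a b hp hp3 hr hN ha hb hd
    refine ⟨hp, hp3, ((h1 p r hp hp3 hr).2).2 ?_⟩
    rcases hD with ⟨hk, hb0⟩ | ⟨hk, hb0⟩
    · exact Or.inl ⟨hk, hs.1.2 hb0⟩
    · exact Or.inr ⟨hk, hs.2.2 hb0⟩


/-- Consistency check only (an `example`, so nothing sorry-tainted concluding the crux enters the
environment — a later `exact?` probe importing this file cannot pick up a fake proof of the crux): the
composition typechecks against the five stubs exactly as stated (each stub inhabits its `Registered` alias). -/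
example : KsLowerClassesMemBQP :=
  KsLowerClassesMemBQP_of stub_tritDictionary stub_cubicGaussSumPhase stub_eisensteinDatum
    stub_exactSectorWithAdvice stub_sectorSignFrontEnd

end Summit.QuantumAdvantage.QuantumAdvantage.Cruxes.KsLowerClassesMemBQP.Birth

end
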